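import Literature.Computability.QuantumComplexity.OracleSubstitutionWeighted
import HarnessLib

/-!
# Substituting subroutines for oracle gates: the weights of the bound are BBBV's query magnitudes

Topic `Literature/Computability/QuantumComplexity`, a corollary file of `OracleSubstitutionWeighted.lean`
(`OracleImpl.l2Norm_substGates_tidy_sub_le`: substituting the tidy blocks of deciders costs at most
`Σ_t 2√(Σ_q errProb_t(q) · w_t(q))`, `w_t(q) = OracleImpl.placedQueryWeight …` the weight of the query
`q` at the `t`-th oracle gate of the ideal run, defined through the fibres of the block placement). This
file identifies those weights with the quantity the analysis of an oracle algorithm naturally provides: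
BBBV's **query magnitude** (Bennett–Bernstein–Brassard–Vazirani 1997, Def. 3.2: "the sum of squared
magnitudes in `|φ_i⟩` of configurations … querying the oracle on string `y`"; the tree's
`queryWeight D e ψ` of `HybridArgument.lean`, equal for a unit vector to the probability of the query
register under the Born law, `queryWeight_eq_toReal_queryMarginal` of `OracleGateReplacementBorn.lean`):

* `OracleImpl.queryOf_eq_ofFn_query` — the query string read along the oracle gate's wires `e` is the
  query content of the block register read along the block placement;
* **`OracleImpl.placedQueryWeight_eq_queryWeight`** — for a state clean above the original register
  (`CleanAbove N W`), `placedQueryWeight (blockEmb e off …) ψ q = queryWeight {ofFn q} (e ⊂ W) ψ`: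
  the weight of `q` is the query magnitude of the single string `q` at the placed gate.

Consequently the substitution bound reads `Σ_t 2√(E_{w ∼ Q_t}[ε_t(w)])`, `Q_t` the query marginal of the
ideal run at gate `t` — a CLASSICAL distribution, which is what the provider of an oracle algorithm
(e.g. the quantum sampler of Regev 2009, Lemma 3.14) computes.

Everything is proved; no named fact is introduced.

## References

* C. H. Bennett, E. Bernstein, G. Brassard, U. Vazirani, *Strengths and weaknesses of quantum
  computing*, SIAM J. Comput. 26 (1997) 1510–1523, Def. 3.2, Thm. 3.3, Thm. 4.14
  [BennettBernsteinBrassardVazirani1997].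
* O. Regev, *On lattices, learning with errors, random linear codes, and cryptography*, J. ACM 56
  (2009), art. 34, Lemmas 3.3, 3.14 [Regev2009].
-/

noncomputable section

namespace Literature.Computability.QuantumComplexity

open Cryptography Matrix

namespace OracleImpl

variable {k N W a : ℕ}

/-- **The query string of the oracle gate is the query content of the block register**: along the
placement `E` of a block on the oracle gate `oracle k e`, `queryOf (e ⊂ W) z = ofFn (query (z ∘ E))`.
[folklore] -/
theorem queryOf_eq_ofFn_query {d : ℕ} (e : Fin (k + 1) ↪ Fin N) (off : ℕ) (hN : N ≤ off) (hW : off + (k + d) ≤ W)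
    (hNW : N ≤ W) (z : QReg W) :
    queryOf (e.trans (Fin.castLEEmb hNW)) z = List.ofFn (TidyBlock.query (z ∘ blockEmb e off (k + d) hN hW)) := by
  unfold queryOf TidyBlock.query
  refine congrArg List.ofFn (funext fun i => ?_)
  rw [← castAddEmb_trans_blockEmb e off (k + d) hN hW hNW]
  rfl

/-- A block ancilla wire of a placed block lies above the original register. [folklore] -/
theorem le_blockEmb_dE {d : ℕ} (e : Fin (k + 1) ↪ Fin N) (off : ℕ) (hN : N ≤ off) (hW : off + (k + d) ≤ W)
    (j : Fin (k + d)) : N ≤ ((blockEmb e off (k + d) hN hW) (TidyBlock.dE k d j) : ℕ) := by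
  rw [show TidyBlock.dE k d j = Fin.natAdd (k + 1) j from rfl, blockEmb_apply, blockMap_natAdd]
  simp only
  omega

/-- **The weight of a query at a placed tidy block is BBBV's query magnitude of that string** at the
placed oracle gate, for every state clean above the original register.
[cite: BennettBernsteinBrassardVazirani1997, Def. 3.2] -/
theorem placedQueryWeight_eq_queryWeight {d : ℕ} (e : Fin (k + 1) ↪ Fin N) (off : ℕ) (hN : N ≤ off)
    (hW : off + (k + d) ≤ W) (hNW : N ≤ W) (ψ : QReg W → ℂ) (hψ : SuppIn (CleanAbove N W) ψ) (q : QReg k) :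
    placedQueryWeight (blockEmb e off (k + d) hN hW) ψ q = queryWeight {List.ofFn q} (e.trans (Fin.castLEEmb hNW)) ψ := by
  classical
  set E := blockEmb e off (k + d) hN hW with hE
  set sw := splitWires E with hsw
  unfold queryWeight placedQueryWeight
  rw [← Equiv.sum_comp sw.symm, Fintype.sum_prod_type, Finset.sum_comm]
  refine Finset.sum_congr rfl fun r _ => ?_
  -- on the fibre `r`: only the two registers `reg q b 0…0` contribute
  have hcond : ∀ y : QReg (TidyBlock.W k d),
      (queryOf (e.trans (Fin.castLEEmb hNW)) (sw.symm (y, r)) ∈ ({List.ofFn q} : Set (List Bool))) ↔ TidyBlock.query y = q := by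
    intro y
    rw [Set.mem_singleton_iff, queryOf_eq_ofFn_query e off hN hW hNW, hsw, splitWires_symm_comp, List.ofFn_inj]
  have hzero : ∀ y : QReg (TidyBlock.W k d), y ∘ TidyBlock.dE k d ≠ TidyBlock.zf k d → ψ (sw.symm (y, r)) = 0 := by
    intro y hy
    apply hψ
    intro hclean
    apply hy
    funext j
    have h1 := hclean (E (TidyBlock.dE k d j)) (le_blockEmb_dE e off hN hW j)
    have h2 : (sw.symm (y, r)) (E (TidyBlock.dE k d j)) = y (TidyBlock.dE k d j) := by
      have := congrFun (splitWires_symm_comp E y r) (TidyBlock.dE k d j)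
      simpa only [Function.comp_apply, hsw] using this
    rw [Function.comp_apply, ← h2, h1]
    rfl
  symm
  refine (Finset.sum_subset (Finset.subset_univ (Finset.univ.image fun b : Bool => TidyBlock.reg q b (TidyBlock.zf k d)))
    fun y _ hy => ?_).symm.trans ?_
  · -- registers off the image contribute nothing
    by_cases hq : TidyBlock.query y = q
    · have hd : y ∘ TidyBlock.dE k d ≠ TidyBlock.zf k d := by
        intro hd
        apply hy
        refine Finset.mem_image.2 ⟨y (TidyBlock.bW k d), Finset.mem_univ _, ?_⟩
        rw [← hq, ← hd, TidyBlock.reg_eta]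
      rw [hzero y hd]
      simp
    · rw [if_neg ((hcond y).not.2 hq)]
  · rw [Finset.sum_image fun b _ b' _ h => ((TidyBlock.reg_injective_iff _ _ _ _ _ _).1 h).2.1, TidyBlock.queryWeight]
    refine Finset.sum_congr rfl fun b _ => ?_
    rw [if_pos ((hcond _).2 (TidyBlock.query_reg q b _))]
    rfl

end OracleImpl

end Literature.Computability.QuantumComplexity

end
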